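import Summits.BirchSwinnertonDyer.BirchSwinnertonDyer.Theorems.GenusKolyvaginAtTwoVisiblePairAtTwoCebotarev
import Literature.NumberTheory.EllipticCurves.NonEisensteinPrimeOfSurjective
import Literature.NumberTheory.DiophantineGeometry.MinimalDiscriminantRingOfIntegersProofs
import HarnessLib

/-!
# Route `GenusKolyvaginAtTwo`, LINE 6, KEY crux Q3 (inner statement of stmt-BirchSwinnertonDyer-22137):
# the instance's Kolyvagin primes `kolPrime` ARE Zhang–Kolyvagin primes — `(ℓ)` is prime in `𝓞 K`, `ℓ ∤ N_E`
# (converse of gk2-p2's `kolPrime_of_isKolyvaginPrime`)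

Helper (seat `bsd-line-gk2-p3` g13; `--supports` the crux, closes nothing). The pair instance
`VisiblePairAtTwo.Input` (p638903) indexes its classes by `KolSupp (kolPrime W K M)`, where `kolPrime W K M ℓ` records
inertness as "every place `w ∋ ℓ` of `K` has residue degree `2`"; the tree's Heegner-point machinery
(`KolyvaginHeegnerData`, `nonempty_kolyvaginHeegnerData_of_grossCM`, the sign law `…KolyvaginClassSign`, Zhang's
`IsKolyvaginPrime`) records it as "`(ℓ) = ℓ𝓞_K` is a prime ideal". gk2-p2's `kolPrime_of_isKolyvaginPrime` goes from Zhang's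
predicate (+ Frobenius data) to `kolPrime`; this file supplies the converse, needed to FEED the Heegner data into the
instance (the classes `c_K(m) := c_M(m)` at every `m ∈ KolSupp (kolPrime W K M)`):

* `span_natCast_isPrime_of_inertiaDeg_eq_two` — **in a quadratic field, a rational prime `ℓ` under a place of residue
  degree `2` generates a prime ideal** (`absNorm (ℓ) = ℓ² = absNorm w`, so `(ℓ) = w`);
* `span_natCast_isPrime_of_kolPrime`, `not_dvd_conductorNorm_of_kolPrime`, `isKolyvaginPrime_of_kolPrime` —
  **`kolPrime W K M ℓ ⟹ Zhang2014.IsKolyvaginPrime N_E W K 2 ℓ ∧ M ≤ kolyvaginIndex W 2 ℓ`** (`1 ≤ M`), and the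
  `KolSupp` form `kolSupp_zhang_of_kolSupp_kolPrime`.

THEOREMS ONLY (no definition, no named fact, no `sorry`, standard axioms). BSD is not proved by any of this.

References: [GrossLMS1991] §3 (3.1)–(3.3) ("the prime `(ℓ)` remains inert in `K`"); [NeukirchANT1999] Ch. I (8.2);
[WZhang2014] Notations (xii).
-/

set_option autoImplicit false
set_option linter.dupNamespace false -- tree convention: `Summit.BirchSwinnertonDyer.BirchSwinnertonDyer.Theorems` (summit = sub-problem)

noncomputable section

open scoped Classical

namespace Summit.BirchSwinnertonDyer.BirchSwinnertonDyer.Theorems.GenusExact.VisiblePairAtTwo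

open WeierstrassCurve NumberField IsDedekindDomain Field Rat.HeightOneSpectrum
open Literature.NumberTheory.EllipticCurves Literature.NumberTheory.GaloisRepresentations
open Literature.NumberTheory.EllipticCurves.KolyvaginDescent

variable {K : Type} [Field K] [NumberField K]

/-! ## §1 A prime under a place of residue degree `2` of a quadratic field is inert -/

/-- **`(ℓ)` is prime in `𝓞 K` when `[K : ℚ] = 2` and some place `w ∋ ℓ` has residue degree `2`**: `(ℓ) ⊆ w` and both
ideals have absolute norm `ℓ²` (`absNorm (ℓ) = ℓ^{[K:ℚ]}`, `absNorm w = ℓ^{f(w|ℓ)}`), so `(ℓ) = w`.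
[cite: NeukirchANT1999, Ch. I Prop. (8.2)] [cite: GrossLMS1991, §3] -/
theorem span_natCast_isPrime_of_inertiaDeg_eq_two (h2 : Module.finrank ℚ K = 2) {ℓ : ℕ} (hℓ : ℓ.Prime)
    (w : HeightOneSpectrum (𝓞 K)) (hℓw : (ℓ : 𝓞 K) ∈ w.asIdeal) (hf : w.asIdeal.inertiaDeg (𝓞 ℚ) = 2) :
    (Ideal.span {(ℓ : 𝓞 K)}).IsPrime := by
  set v : HeightOneSpectrum (𝓞 ℚ) := primesEquiv.symm ⟨ℓ, hℓ⟩ with hv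
  have hgen : natGenerator v = ℓ := congrArg Subtype.val (primesEquiv.apply_symm_apply (⟨ℓ, hℓ⟩ : Nat.Primes))
  -- `w` lies over `v`
  have hu : w.under (𝓞 ℚ) = v := (natCast_prime_mem_iff_eq hℓ (w.under (𝓞 ℚ))).mp (by
    rw [HeightOneSpectrum.under_asIdeal, Ideal.under_def, Ideal.mem_comap, map_natCast]
    exact hℓw)
  haveI hwv : w.asIdeal.LiesOver v.asIdeal := ⟨by rw [← hu]; rfl⟩
  haveI : v.asIdeal.IsMaximal := v.isMaximal
  haveI : w.asIdeal.IsMaximal := w.isMaximal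
  -- the two norms
  have hNw : Ideal.absNorm w.asIdeal = ℓ ^ 2 := by
    rw [Ideal.absNorm_eq_pow_inertiaDeg'_of_liesOver w.asIdeal v.asIdeal v.isPrime v.ne_bot,
      Ideal.inertiaDeg'_eq_inertiaDeg v.asIdeal w.asIdeal, hf,
      Literature.NumberTheory.DiophantineGeometry.MinimalDiscriminant.absNorm_asIdeal_eq_natGenerator v, hgen]
  have hNℓ : Ideal.absNorm (Ideal.span {(ℓ : 𝓞 K)}) = ℓ ^ 2 := by
    rw [Ideal.absNorm_span_singleton, show (ℓ : 𝓞 K) = algebraMap ℤ (𝓞 K) (ℓ : ℤ) by simp,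
      Algebra.norm_algebraMap, RingOfIntegers.rank, h2, Int.natAbs_pow, Int.natAbs_natCast]
  -- `w ∣ (ℓ)` with cofactor of norm `1`
  have hle : Ideal.span {(ℓ : 𝓞 K)} ≤ w.asIdeal := (Ideal.span_singleton_le_iff_mem _).mpr hℓw
  obtain ⟨J, hJ⟩ := Ideal.dvd_iff_le.mpr hle
  have hJ1 : Ideal.absNorm J = 1 := by
    have h := congrArg Ideal.absNorm hJ
    rw [map_mul, hNℓ, hNw] at h
    have hℓ0 : (ℓ ^ 2 : ℕ) ≠ 0 := pow_ne_zero _ hℓ.ne_zero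
    have h' : ℓ ^ 2 * Ideal.absNorm J = ℓ ^ 2 * 1 := by rw [mul_one]; exact h.symm
    exact Nat.eq_of_mul_eq_mul_left (Nat.pos_of_ne_zero hℓ0) h'
  rw [Ideal.absNorm_eq_one_iff] at hJ1
  rw [hJ, hJ1, Ideal.mul_top]
  exact w.isPrime

/-! ## §2 `kolPrime ⟹ Zhang2014.IsKolyvaginPrime` -/

variable (W : WeierstrassCurve ℚ) [W.IsElliptic] [W.IsGloballyMinimal] (M : ℕ)

omit [W.IsElliptic] in
/-- **The instance's Kolyvagin primes are inert**: `kolPrime W K M ℓ ⟹ (ℓ)` is prime in `𝓞 K` (`[K : ℚ] = 2`).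
[cite: GrossLMS1991, §3 (3.1)] -/
theorem span_natCast_isPrime_of_kolPrime (h2 : Module.finrank ℚ K = 2) {ℓ : ℕ} (h : kolPrime W K M ℓ) :
    (Ideal.span {(ℓ : 𝓞 K)}).IsPrime := by
  obtain ⟨hℓ, -, -, -, -, -, -, hinert⟩ := h
  set v : HeightOneSpectrum (𝓞 ℚ) := primesEquiv.symm ⟨ℓ, hℓ⟩ with hv
  obtain ⟨w, hw⟩ := exists_liesOver K v
  have hℓw : (ℓ : 𝓞 K) ∈ w.asIdeal := by
    have h1 : algebraMap (𝓞 ℚ) (𝓞 K) (ℓ : 𝓞 ℚ) ∈ w.asIdeal := by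
      rw [← Ideal.mem_comap, ← Ideal.under_def, ← hw.over]
      exact natCast_mem_primesEquiv_symm hℓ
    rwa [map_natCast] at h1
  exact span_natCast_isPrime_of_inertiaDeg_eq_two h2 hℓ w hℓw (hinert w hℓw)

/-- **The instance's Kolyvagin primes do not divide the conductor** (good reduction at `ℓ`).
[cite: Silverman1994, IV.10.2(a)] -/
theorem not_dvd_conductorNorm_of_kolPrime {ℓ : ℕ} (h : kolPrime W K M ℓ) : ¬ ℓ ∣ W.conductorNorm ℤ := by
  obtain ⟨hℓ, -, -, hgood, -⟩ := h
  haveI : Fact ℓ.Prime := ⟨hℓ⟩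
  exact not_dvd_conductorNorm_of_hasGoodReductionAtPrime W hgood

/-- **`kolPrime W K M ℓ ⟹ Zhang2014.IsKolyvaginPrime N_E W K 2 ℓ ∧ M ≤ kolyvaginIndex W 2 ℓ`** (`[K : ℚ] = 2`, `1 ≤ M`):
prime, `ℓ ∤ N_E` (good reduction), `ℓ ∤ d_K`, `ℓ ≠ 2`, `(ℓ)` prime (§1), index `≥ M ≥ 1`. The converse of gk2-p2's
`kolPrime_of_isKolyvaginPrime` (which also consumes the two Frobenius conditions). [cite: WZhang2014, Notations (xii)]
[cite: GrossLMS1991, §3 (3.1)–(3.3)] -/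
theorem isKolyvaginPrime_of_kolPrime (h2 : Module.finrank ℚ K = 2) (hM : 1 ≤ M) {ℓ : ℕ} (h : kolPrime W K M ℓ) :
    Zhang2014.IsKolyvaginPrime (W.conductorNorm ℤ) W K 2 ℓ ∧ M ≤ Zhang2014.kolyvaginIndex W 2 ℓ := by
  have hsp := span_natCast_isPrime_of_kolPrime W M h2 h
  have hN := not_dvd_conductorNorm_of_kolPrime W M h
  obtain ⟨hℓ, hℓ2, hℓd, -, -, -, hidx, -⟩ := h
  exact ⟨⟨hℓ, hN, hℓd, hℓ2, hsp, lt_of_lt_of_le (by omega) hidx⟩, hidx⟩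

/-- **`KolSupp (kolPrime W K M) n ⟹` `n` is square-free with every prime factor a Zhang–Kolyvagin prime at `2` of index `≥ M`**
(the binder shape of `KolyvaginHeegnerData`-based statements: the sign law `…KolyvaginClassSign`, Q2, Gross's CM data).
[cite: WZhang2014, Notations (xii)] -/
theorem kolSupp_zhang_of_kolSupp_kolPrime (h2 : Module.finrank ℚ K = 2) (hM : 1 ≤ M) {n : ℕ}
    (h : KolSupp (kolPrime W K M) n) :
    Squarefree n ∧ ∀ ℓ ∈ n.primeFactors,
      Zhang2014.IsKolyvaginPrime (W.conductorNorm ℤ) W K 2 ℓ ∧ M ≤ Zhang2014.kolyvaginIndex W 2 ℓ :=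
  ⟨h.1, fun ℓ hℓ ↦ isKolyvaginPrime_of_kolPrime W M h2 hM (h.2 ℓ hℓ)⟩

omit [W.IsElliptic] in
/-- The inertness clause alone, at every prime factor (the `hinert` input of `nonempty_kolyvaginHeegnerData_of_grossCM`).
[cite: GrossLMS1991, §3] -/
theorem forall_span_isPrime_of_kolSupp_kolPrime (h2 : Module.finrank ℚ K = 2) {n : ℕ}
    (h : KolSupp (kolPrime W K M) n) : ∀ ℓ ∈ n.primeFactors, (Ideal.span {(ℓ : 𝓞 K)}).IsPrime :=
  fun ℓ hℓ ↦ span_natCast_isPrime_of_kolPrime W M h2 (h.2 ℓ hℓ)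

end Summit.BirchSwinnertonDyer.BirchSwinnertonDyer.Theorems.GenusExact.VisiblePairAtTwo

end
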